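import Mathlib
import Summits.QuantumAdvantage.QuantumAdvantage.Theorems.MobiusLadderQuadraticDigitPhasesStubNoExactB

/-!
# No exact twisted cycle (stub `stub_noExactTwistedCycle`): endgame and assembly

The lead's stub `stub_noExactTwistedCycle` of the crux `MobiusLadder.QuadraticDigitPhases`
(stmt-QuantumAdvantage-1391), line `Sketch`, uniformly for ALL pairs of distinct odd primes `p ≠ q`:
for the invariant vector `π` of the untwisted pair-carry letter there is `m₀` (here `m₀ = pq + 2`)
such that every generalized word in the letters `M_{ab}` and `Π = 𝟙 ⊗ π` with at least `m₀` twisted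
letters has absolute row sums `< 1` at every reachable state, i.e. is `ℓ¹`-INEXACT from every
reachable basis vector.  With the landed `stub_uwcOfNoExact` (compactness), `stub_stationary` and
`stub_wordDecayOfUWC` this gives WORD DECAY of the pair-carry transfer words for every pair of
distinct odd primes — the root of the HIGH branch of line `Sketch`.

Proof (parts A, B contain the lemmas).  Suppose a word is exact from `e_s`.  Every letter is an
`ℓ¹`-contraction, so every prefix and every single step is exact.  (1) SUPPORT FILLS: along exact
steps a charged state charges both digit targets (`apply_ne_zero`), so after the first `pq` letters
either a `Π` occurred — then the vector is `(Σu) π` with `Σ u ≠ 0`, charging every cell — or the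
prefix is plain and `charge_spread` + `stub_gridReach` (`2^{pq} ≥ pq`) charge every cell
(`full_of_exact_plain`).  (2) ENDGAME (`endgame₂`, `endgame₁`): on a fully charged vector an exact
step yields a vector with ONE strict sign on all cells (`next_step`: for `M_{ab}`, `fst_eq_snd` gives
`a = b` and `sign_propagate` the sign; for `Π`, exactness forbids discordant pairs); from a strictly
single-signed fully charged vector an exact twisted letter is impossible (it would be `M₁₁`, whose
pattern `(-1)^{r+r'}` differs between `(0,0)` and the next cell), while exact untwisted steps keep the
invariant.  So at most one twisted letter survives after the support has filled, and `pq + 2` twisted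
letters force a strict loss.  No case analysis on `(p, q)` and no computation is involved.
-/

set_option linter.dupNamespace false -- D-0017: single-problem summit ⇒ `QuantumAdvantage.QuantumAdvantage` by design

namespace Summit.QuantumAdvantage.QuantumAdvantage.Theorems.MobiusLadderQuadraticDigitPhasesStubNoExactTwistedCycle

open Finset
open scoped Matrix
open Summit.QuantumAdvantage.QuantumAdvantage.Theorems.MobiusLadderQuadraticDigitPhasesStubNoExactA
open Summit.QuantumAdvantage.QuantumAdvantage.Theorems.MobiusLadderQuadraticDigitPhasesStubNoExactB
open Summit.QuantumAdvantage.QuantumAdvantage.Theorems.MobiusLadderQuadraticDigitPhasesStubUwcOfNoExact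
  (l1_vecMul_le l1_mul_prod_le supp_vecMul)
open Summit.QuantumAdvantage.QuantumAdvantage.Theorems.MobiusLadderQuadraticDigitPhasesStubWordDecayOfUWC
  (sum_abs_letter_le abs_twist reach_step support_vecMul_prod)

section SignAnalysis

variable {p q : ℕ} (hp : p.Prime) (hq : q.Prime) (hpq : p ≠ q) (hp2 : 2 < p) (hq2 : 2 < q)
variable {M : Bool × Bool → Matrix (Fin p × Fin q) (Fin p × Fin q) ℝ}
  (hM : M = fun ab : Bool × Bool => (Matrix.of fun (x y : Fin p × Fin q) =>
      ∑ t ∈ ({0, 1} : Finset ℕ),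
        if (y.1 : ℕ) = (p * t + x.1) / 2 ∧ (y.2 : ℕ) = (q * t + x.2) / 2 then
          (1 / 2 : ℝ) * (if ab.1 then (-1 : ℝ) ^ ((p * t + x.1) % 2) else 1) *
            (if ab.2 then (-1 : ℝ) ^ ((q * t + x.2) % 2) else 1)
        else 0))
variable {π : Fin p × Fin q → ℝ}
  (hπpos : ∀ s : Fin p × Fin q,
    (∃ c T : ℕ, T < 2 ^ c ∧ (s.1 : ℕ) = p * T / 2 ^ c ∧ (s.2 : ℕ) = q * T / 2 ^ c) → 0 < π s)
  (hπzero : ∀ s : Fin p × Fin q,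
    ¬ (∃ c T : ℕ, T < 2 ^ c ∧ (s.1 : ℕ) = p * T / 2 ^ c ∧ (s.2 : ℕ) = q * T / 2 ^ c) → π s = 0)
  (hπsum : ∑ s : Fin p × Fin q, π s = 1)
  (hπinv : ∀ y : Fin p × Fin q, ∑ x : Fin p × Fin q, π x * (Matrix.of fun (x y : Fin p × Fin q) =>
    ∑ t ∈ ({0, 1} : Finset ℕ),
      if (y.1 : ℕ) = (p * t + x.1) / 2 ∧ (y.2 : ℕ) = (q * t + x.2) / 2 then (1 / 2 : ℝ) else 0) x y
      = π y)
variable {Λ : Option (Bool × Bool) → Matrix (Fin p × Fin q) (Fin p × Fin q) ℝ}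
  (hΛ : Λ = fun l : Option (Bool × Bool) => l.elim (Matrix.of fun (_ y : Fin p × Fin q) => π y) M)

include hp hq hpq hp2 hq2 hM hπpos hπzero hπsum hπinv hΛ in
/-- ONE EXACT STEP FROM A FULLY CHARGED VECTOR.  If `v` charges every cell, is carried by the
reachable states, and the generalized letter `l` is exact on `v`, then `v' = v Λ_l` has one (weak) sign
— that of `v (0,0)` — everywhere, charges every cell, and is carried by the reachable states.  For a
letter `M_{ab}` this is `fst_eq_snd` + `sign_propagate` (every entry `v x · M_{ab} x y` is
`½ ε_{ab}(x) v x`); for `Π` exactness makes `v` single-signed, so `v' = (Σ v) π`. -/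
theorem next_step (l : Option (Bool × Bool)) (v : Fin p × Fin q → ℝ)
    (hfull : ∀ x : Fin p × Fin q,
      (x.1 : ℕ) * q < ((x.2 : ℕ) + 1) * p ∧ (x.2 : ℕ) * p < ((x.1 : ℕ) + 1) * q → v x ≠ 0)
    (hsupp : ∀ x : Fin p × Fin q, v x ≠ 0 →
      ∃ c T : ℕ, T < 2 ^ c ∧ (x.1 : ℕ) = p * T / 2 ^ c ∧ (x.2 : ℕ) = q * T / 2 ^ c)
    (hex : ∑ z, |(v ᵥ* Λ l) z| = ∑ s, |v s|) :
    (∀ y, 0 ≤ (v ᵥ* Λ l) y * v ((⟨0, hp.pos⟩, ⟨0, hq.pos⟩) : Fin p × Fin q)) ∧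
    (∀ y : Fin p × Fin q,
      (y.1 : ℕ) * q < ((y.2 : ℕ) + 1) * p ∧ (y.2 : ℕ) * p < ((y.1 : ℕ) + 1) * q → (v ᵥ* Λ l) y ≠ 0) ∧
    (∀ y : Fin p × Fin q, (v ᵥ* Λ l) y ≠ 0 →
      ∃ c T : ℕ, T < 2 ^ c ∧ (y.1 : ℕ) = p * T / 2 ^ c ∧ (y.2 : ℕ) = q * T / 2 ^ c) := by
  classical
  have hoo : ((0 : ℕ)) * q < ((0 : ℕ) + 1) * p ∧ (0 : ℕ) * p < ((0 : ℕ) + 1) * q := by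
    constructor <;> simp [hp.pos, hq.pos]
  have hvo := hfull ((⟨0, hp.pos⟩, ⟨0, hq.pos⟩) : Fin p × Fin q) hoo
  refine ⟨?_, ?_, fun y hy => supp_vecMul _ (Λ l) (fun x z hx h => letter_reach hM hπzero hΛ l x z hx h)
    v hsupp y hy⟩
  · -- one weak sign
    cases l with
    | none =>
      have hPi : ∀ y, (v ᵥ* Λ none) y = (∑ x, v x) * π y := fun y => by
        subst hΛ
        simp only [Matrix.vecMul, dotProduct, Option.elim_none, Matrix.of_apply, Finset.sum_mul]
      -- exactness makes `v` weakly single-signed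
      have habs : |∑ x, v x| = ∑ x, |v x| := by
        have h1 : ∑ z, |(v ᵥ* Λ none) z| = |∑ x, v x| := by
          simp_rw [hPi, abs_mul]
          rw [← Finset.mul_sum, Finset.sum_congr rfl fun z _ => abs_of_nonneg (pi_nonneg hπpos hπzero z),
            hπsum, mul_one]
        rw [← h1, hex]
      have hsame : ∀ x, 0 ≤ v x * v ((⟨0, hp.pos⟩, ⟨0, hq.pos⟩) : Fin p × Fin q) := by
        intro x
        by_contra hneg
        have hxo : x ≠ ((⟨0, hp.pos⟩, ⟨0, hq.pos⟩) : Fin p × Fin q) := fun h => by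
          rw [h] at hneg; exact hneg (mul_self_nonneg _)
        have := Summit.QuantumAdvantage.QuantumAdvantage.Theorems.MobiusLadderQuadraticDigitPhasesStubL1Strict.abs_sum_lt_sum_abs
          univ v (mem_univ x) (mem_univ _) hxo (lt_of_not_ge hneg)
        exact absurd habs this.ne
      intro y
      rw [hPi, mul_comm (∑ x, v x), mul_assoc, Finset.sum_mul]
      exact mul_nonneg (pi_nonneg hπpos hπzero y) (Finset.sum_nonneg fun x _ => hsame x)
    | some ab =>
      obtain ⟨a, b⟩ := ab
      have hexM : ∑ z, |(v ᵥ* M (a, b)) z| = ∑ s, |v s| := by subst hΛ; simpa using hex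
      have hab := fst_eq_snd hp hq hpq hp2 hq2 hM a b v hfull hexM
      subst hab
      have hsg := sign_propagate hp hq hpq hp2 hq2 hM a a v hfull hexM
      have hpo : p % 2 = 1 := hp.eq_two_or_odd.resolve_left (by omega)
      have hqo : q % 2 = 1 := hq.eq_two_or_odd.resolve_left (by omega)
      intro y
      have hΛM : (v ᵥ* Λ (some (a, a))) y = ∑ x, v x * M (a, a) x y := by subst hΛ; rfl
      rw [hΛM, Finset.sum_mul]
      refine Finset.sum_nonneg fun x _ => ?_
      by_cases hvx : v x = 0
      · simp [hvx]
      have hx := hsg x (cell_of_reach hp.pos hq.pos x (hsupp x hvx))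
      by_cases hy0 : (y.1 : ℕ) = (p * 0 + x.1) / 2 ∧ (y.2 : ℕ) = (q * 0 + x.2) / 2
      · rw [letter_entry hp.two_le M hM (a, a) x y 0 zero_le_one hy0]
        simp only [mul_zero, zero_add]
        nlinarith [hx]
      by_cases hy1 : (y.1 : ℕ) = (p * 1 + x.1) / 2 ∧ (y.2 : ℕ) = (q * 1 + x.2) / 2
      · rw [letter_entry hp.two_le M hM (a, a) x y 1 le_rfl hy1]
        simp only
        rw [twist_one hpo hqo a a x]
        have hS : (if a then (-1 : ℝ) else 1) * (if a then (-1 : ℝ) else 1) = 1 := by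
          cases a <;> norm_num
        rw [hS, one_mul]
        nlinarith [hx]
      · rw [letter_entry_zero M hM (a, a) x y (fun t ht => ?_)]
        · simp
        rcases Nat.le_one_iff_eq_zero_or_eq_one.mp ht with rfl | rfl
        · exact hy0
        · exact hy1
  · -- every cell stays charged
    cases l with
    | none =>
      have hPi : ∀ y, (v ᵥ* Λ none) y = (∑ x, v x) * π y := fun y => by
        subst hΛ
        simp only [Matrix.vecMul, dotProduct, Option.elim_none, Matrix.of_apply, Finset.sum_mul]
      have hsum : (∑ x, v x) ≠ 0 := by
        intro h0
        have h1 : ∑ z, |(v ᵥ* Λ none) z| = 0 := by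
          simp_rw [hPi, h0, zero_mul, abs_zero, Finset.sum_const_zero]
        rw [h1] at hex
        have : |v ((⟨0, hp.pos⟩, ⟨0, hq.pos⟩) : Fin p × Fin q)| ≤ ∑ s, |v s| :=
          Finset.single_le_sum (fun s _ => abs_nonneg (v s)) (mem_univ _)
        rw [← hex] at this
        exact hvo (abs_nonpos_iff.mp this)
      intro y hy
      rw [hPi]
      exact mul_ne_zero hsum (hπpos y (reach_of_cell hp hq hpq hp2 hq2 M hM π hπpos hπzero hπinv y hy)).ne'
    | some ab =>
      have hexM : ∑ z, |(v ᵥ* M ab) z| = ∑ s, |v s| := by subst hΛ; simpa using hex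
      intro y hy
      have : (v ᵥ* Λ (some ab)) y = (v ᵥ* M ab) y := by subst hΛ; rfl
      rw [this]
      exact pred_target hp hq hpq hp2 hq2 hM hπpos hπzero hπinv ab v hfull hexM y hy

include hp hq hpq hp2 hq2 hM hπpos hπzero hπsum hπinv hΛ in
/-- ENDGAME, phase 1.  From a vector with one strict sign on all cells (carried by the reachable
states), every generalized word with at least one twisted letter loses `ℓ¹`-mass strictly: exact
untwisted steps keep the invariant (`next_step`), and an exact twisted letter is impossible — it would
have `a = b` (`fst_eq_snd`), i.e. be `M₁₁`, whose pattern `(-1)^{r+r'}` changes sign between the cell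
`(0,0)` and the next cell, contradicting `sign_propagate`. -/
theorem endgame₁ : ∀ (W : List (Option (Bool × Bool))) (v : Fin p × Fin q → ℝ) (σ : ℝ),
    (∀ x : Fin p × Fin q,
      (x.1 : ℕ) * q < ((x.2 : ℕ) + 1) * p ∧ (x.2 : ℕ) * p < ((x.1 : ℕ) + 1) * q → 0 < σ * v x) →
    (∀ x : Fin p × Fin q, v x ≠ 0 →
      ∃ c T : ℕ, T < 2 ^ c ∧ (x.1 : ℕ) = p * T / 2 ^ c ∧ (x.2 : ℕ) = q * T / 2 ^ c) →
    1 ≤ (W.filter (fun l => l ≠ none ∧ l ≠ some (false, false))).length →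
    ∑ z, |(v ᵥ* (W.map Λ).prod) z| < ∑ s, |v s| := by
  classical
  have hrows := letter_rows hM hπpos hπzero hπsum hΛ
  have hoo : ((0 : ℕ)) * q < ((0 : ℕ) + 1) * p ∧ (0 : ℕ) * p < ((0 : ℕ) + 1) * q := by
    constructor <;> simp [hp.pos, hq.pos]
  intro W
  induction W with
  | nil => intro v σ _ _ h; simp at h
  | cons l W ih =>
    intro v σ hsgn hsupp hcnt
    have hfull : ∀ x : Fin p × Fin q,
        (x.1 : ℕ) * q < ((x.2 : ℕ) + 1) * p ∧ (x.2 : ℕ) * p < ((x.1 : ℕ) + 1) * q → v x ≠ 0 := by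
      intro x hx h0
      have := hsgn x hx
      rw [h0, mul_zero] at this
      exact lt_irrefl _ this
    have hvo := hfull ((⟨0, hp.pos⟩, ⟨0, hq.pos⟩) : Fin p × Fin q) hoo
    rw [List.map_cons, List.prod_cons, ← Matrix.vecMul_vecMul]
    by_cases hex : ∑ z, |(v ᵥ* Λ l) z| = ∑ s, |v s|
    · -- the exact letter is untwisted
      have htw : ¬ (l ≠ none ∧ l ≠ some (false, false)) := by
        rintro ⟨h1, h2⟩
        obtain ⟨⟨a, b⟩, rfl⟩ := Option.ne_none_iff_exists'.mp h1
        have hexM : ∑ z, |(v ᵥ* M (a, b)) z| = ∑ s, |v s| := by subst hΛ; simpa using hex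
        have hab := fst_eq_snd hp hq hpq hp2 hq2 hM a b v hfull hexM
        subst hab
        have ha : a = true := by
          cases a
          · exact absurd rfl h2
          · rfl
        subst ha
        have hsg := sign_propagate hp hq hpq hp2 hq2 hM true true v hfull hexM
        -- the cell after `(0,0)`: `(0,1)` if `p < q`, `(1,0)` if `q < p`
        rcases lt_or_gt_of_ne hpq with hlt | hlt
        · obtain ⟨c₁, hc1, hc2⟩ : ∃ c₁ : Fin p × Fin q, (c₁.1 : ℕ) = 0 ∧ (c₁.2 : ℕ) = 1 :=
            ⟨(⟨0, hp.pos⟩, ⟨1, hq.one_lt⟩), rfl, rfl⟩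
          have hcell : (c₁.1 : ℕ) * q < ((c₁.2 : ℕ) + 1) * p ∧ (c₁.2 : ℕ) * p < ((c₁.1 : ℕ) + 1) * q := by
            rw [hc1, hc2]; constructor <;> omega
          have key := hsg c₁ hcell
          rw [hc1, hc2] at key
          simp only [Nat.zero_mod, Nat.one_mod, pow_zero, pow_one, ite_true, one_mul] at key
          have h3 : 0 < v c₁ * v ((⟨0, hp.pos⟩, ⟨0, hq.pos⟩) : Fin p × Fin q) :=
            pos_of_pos_pos (hsgn c₁ hcell) (hsgn _ hoo)
          linarith
        · obtain ⟨c₁, hc1, hc2⟩ : ∃ c₁ : Fin p × Fin q, (c₁.1 : ℕ) = 1 ∧ (c₁.2 : ℕ) = 0 :=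
            ⟨(⟨1, hp.one_lt⟩, ⟨0, hq.pos⟩), rfl, rfl⟩
          have hcell : (c₁.1 : ℕ) * q < ((c₁.2 : ℕ) + 1) * p ∧ (c₁.2 : ℕ) * p < ((c₁.1 : ℕ) + 1) * q := by
            rw [hc1, hc2]; constructor <;> omega
          have key := hsg c₁ hcell
          rw [hc1, hc2] at key
          simp only [Nat.zero_mod, Nat.one_mod, pow_zero, pow_one, ite_true, mul_one] at key
          have h3 : 0 < v c₁ * v ((⟨0, hp.pos⟩, ⟨0, hq.pos⟩) : Fin p × Fin q) :=
            pos_of_pos_pos (hsgn c₁ hcell) (hsgn _ hoo)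
          linarith
      have hcnt' : 1 ≤ (W.filter (fun l => l ≠ none ∧ l ≠ some (false, false))).length := by
        rw [List.filter_cons_of_neg (by simpa using htw)] at hcnt
        exact hcnt
      obtain ⟨hs1, hs2, hs3⟩ := next_step hp hq hpq hp2 hq2 hM hπpos hπzero hπsum hπinv hΛ l v hfull
        hsupp hex
      have hsgn' : ∀ x : Fin p × Fin q,
          (x.1 : ℕ) * q < ((x.2 : ℕ) + 1) * p ∧ (x.2 : ℕ) * p < ((x.1 : ℕ) + 1) * q →
          0 < v ((⟨0, hp.pos⟩, ⟨0, hq.pos⟩) : Fin p × Fin q) * (v ᵥ* Λ l) x := fun x hx =>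
        lt_of_le_of_ne (by rw [mul_comm]; exact hs1 x) (mul_ne_zero hvo (hs2 x hx)).symm
      exact (ih (v ᵥ* Λ l) _ hsgn' hs3 hcnt').trans_le (l1_vecMul_le (Λ l) (hrows l) v)
    · exact (l1_mul_prod_le Λ hrows W _).trans_lt
        (lt_of_le_of_ne (l1_vecMul_le (Λ l) (hrows l) v) hex)

include hp hq hpq hp2 hq2 hM hπpos hπzero hπsum hπinv hΛ in
/-- ENDGAME, phase 2.  From a vector charging every cell (carried by the reachable states), every
generalized word with at least two twisted letters loses `ℓ¹`-mass strictly: if the first letter is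
exact, `next_step` produces a strictly single-signed fully charged vector and phase 1 applies to the
rest, which still has a twisted letter. -/
theorem endgame₂ (W : List (Option (Bool × Bool))) (v : Fin p × Fin q → ℝ)
    (hfull : ∀ x : Fin p × Fin q,
      (x.1 : ℕ) * q < ((x.2 : ℕ) + 1) * p ∧ (x.2 : ℕ) * p < ((x.1 : ℕ) + 1) * q → v x ≠ 0)
    (hsupp : ∀ x : Fin p × Fin q, v x ≠ 0 →
      ∃ c T : ℕ, T < 2 ^ c ∧ (x.1 : ℕ) = p * T / 2 ^ c ∧ (x.2 : ℕ) = q * T / 2 ^ c)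
    (hcnt : 2 ≤ (W.filter (fun l => l ≠ none ∧ l ≠ some (false, false))).length) :
    ∑ z, |(v ᵥ* (W.map Λ).prod) z| < ∑ s, |v s| := by
  classical
  have hrows := letter_rows hM hπpos hπzero hπsum hΛ
  have hoo : ((0 : ℕ)) * q < ((0 : ℕ) + 1) * p ∧ (0 : ℕ) * p < ((0 : ℕ) + 1) * q := by
    constructor <;> simp [hp.pos, hq.pos]
  have hvo := hfull ((⟨0, hp.pos⟩, ⟨0, hq.pos⟩) : Fin p × Fin q) hoo
  cases W with
  | nil => simp at hcnt
  | cons l W =>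
    rw [List.map_cons, List.prod_cons, ← Matrix.vecMul_vecMul]
    by_cases hex : ∑ z, |(v ᵥ* Λ l) z| = ∑ s, |v s|
    · obtain ⟨hs1, hs2, hs3⟩ := next_step hp hq hpq hp2 hq2 hM hπpos hπzero hπsum hπinv hΛ l v hfull
        hsupp hex
      have hcnt' : 1 ≤ (W.filter (fun l => l ≠ none ∧ l ≠ some (false, false))).length := by
        rw [List.filter_cons] at hcnt
        split_ifs at hcnt
        · simp only [List.length_cons] at hcnt; omega
        · omega
      have hsgn' : ∀ x : Fin p × Fin q,
          (x.1 : ℕ) * q < ((x.2 : ℕ) + 1) * p ∧ (x.2 : ℕ) * p < ((x.1 : ℕ) + 1) * q →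
          0 < v ((⟨0, hp.pos⟩, ⟨0, hq.pos⟩) : Fin p × Fin q) * (v ᵥ* Λ l) x := fun x hx =>
        lt_of_le_of_ne (by rw [mul_comm]; exact hs1 x) (mul_ne_zero hvo (hs2 x hx)).symm
      exact (endgame₁ hp hq hpq hp2 hq2 hM hπpos hπzero hπsum hπinv hΛ W (v ᵥ* Λ l) _ hsgn' hs3
        hcnt').trans_le (l1_vecMul_le (Λ l) (hrows l) v)
    · exact (l1_mul_prod_le Λ hrows W _).trans_lt
        (lt_of_le_of_ne (l1_vecMul_le (Λ l) (hrows l) v) hex)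

include hp hq hpq hp2 hq2 hM hπpos hπzero hπsum hπinv hΛ in
/-- MAIN LEMMA (= the stub with the letters abstracted): every generalized word with at least
`pq + 2` twisted letters is `ℓ¹`-inexact from every reachable state.  The first `pq` letters either
contain a `Π` (then the vector becomes `±π`, charging every cell) or are plain (then `charge_spread`
/ `full_of_exact_plain` charge every cell, `2^{pq} ≥ pq`); at least two twisted letters remain, and
`endgame₂` applies. -/
theorem noExact_main : ∃ m₀ : ℕ, ∀ word : List (Option (Bool × Bool)),
    m₀ ≤ (word.filter (fun l => l ≠ none ∧ l ≠ some (false, false))).length →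
    ∀ s : Fin p × Fin q, (∃ c T : ℕ, T < 2 ^ c ∧ (s.1 : ℕ) = p * T / 2 ^ c ∧ (s.2 : ℕ) = q * T / 2 ^ c) →
    ∑ y : Fin p × Fin q, |((word.map Λ).prod) s y| < 1 := by
  classical
  have hrows := letter_rows hM hπpos hπzero hπsum hΛ
  refine ⟨p * q + 2, fun word hw s hs => ?_⟩
  -- the row at `s` of the word matrix is `e_s` pushed through the word
  have he1 : ∑ x : Fin p × Fin q, |(Pi.single s (1 : ℝ) : Fin p × Fin q → ℝ) x| = 1 := by
    rw [Finset.sum_eq_single_of_mem s (Finset.mem_univ _)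
      (fun x _ hx => by rw [Pi.single_eq_of_ne hx, abs_zero]), Pi.single_eq_same, abs_one]
  have hrow : ∀ y, ((word.map Λ).prod) s y = (Pi.single s (1 : ℝ) ᵥ* (word.map Λ).prod) y :=
    fun y => by rw [Matrix.single_one_vecMul, Matrix.row_apply']
  simp_rw [hrow]
  refine lt_of_lt_of_eq ?_ he1
  have hesupp : ∀ x : Fin p × Fin q, (Pi.single s (1 : ℝ) : Fin p × Fin q → ℝ) x ≠ 0 →
      ∃ c T : ℕ, T < 2 ^ c ∧ (x.1 : ℕ) = p * T / 2 ^ c ∧ (x.2 : ℕ) = q * T / 2 ^ c := by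
    intro x hx
    have hxs : x = s := by
      by_contra hne
      exact hx (Pi.single_eq_of_ne hne _)
    subst hxs
    exact hs
  set k := p * q with hk
  have hZ : 2 ≤ ((word.drop k).filter (fun l => l ≠ none ∧ l ≠ some (false, false))).length := by
    have h1 : (word.filter (fun l => l ≠ none ∧ l ≠ some (false, false))).length =
        ((word.take k).filter (fun l => l ≠ none ∧ l ≠ some (false, false))).length +
        ((word.drop k).filter (fun l => l ≠ none ∧ l ≠ some (false, false))).length := by
      rw [← List.length_append, ← List.filter_append, List.take_append_drop]
    have h2 : ((word.take k).filter (fun l => l ≠ none ∧ l ≠ some (false, false))).length ≤ k :=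
      (List.length_filter_le _ _).trans ((List.length_take_le _ _))
    omega
  rw [← List.take_append_drop k word]
  by_cases hnone : none ∈ word.take k
  · -- a `Π` among the first `k` letters
    obtain ⟨X, Y, hXY⟩ := List.append_of_mem hnone
    rw [hXY, List.append_assoc, List.cons_append,
      show X ++ none :: (Y ++ word.drop k) = (X ++ [none]) ++ (Y ++ word.drop k) by simp]
    by_cases hex : ∑ z, |(Pi.single s (1 : ℝ) ᵥ* ((X ++ [none]).map Λ).prod) z| =
        ∑ x, |(Pi.single s (1 : ℝ) : Fin p × Fin q → ℝ) x|
    · refine lt_of_tail Λ hrows _ (X ++ [none]) (Y ++ word.drop k) (endgame₂ hp hq hpq hp2 hq2 hM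
        hπpos hπzero hπsum hπinv hΛ (Y ++ word.drop k) _ (fun y hy => ?_) ?_ ?_)
      · -- every cell is charged by `u' = (Σ u) π`
        set u := Pi.single s (1 : ℝ) ᵥ* (X.map Λ).prod with hu
        have hsplit : Pi.single s (1 : ℝ) ᵥ* ((X ++ [none]).map Λ).prod = u ᵥ* Λ none := by
          rw [List.map_append, List.prod_append, ← Matrix.vecMul_vecMul, List.map_singleton,
            List.prod_singleton]
        have hPi : ∀ z, (u ᵥ* Λ none) z = (∑ x, u x) * π z := fun z => by
          subst hΛ
          simp only [Matrix.vecMul, dotProduct, Option.elim_none, Matrix.of_apply, Finset.sum_mul]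
        have hsum : (∑ x, u x) ≠ 0 := by
          intro h0
          have h1 : ∑ z, |(u ᵥ* Λ none) z| = 0 := by
            simp_rw [hPi, h0, zero_mul, abs_zero, Finset.sum_const_zero]
          rw [hsplit, h1, he1] at hex
          exact zero_ne_one hex
        rw [hsplit, hPi]
        exact mul_ne_zero hsum
          (hπpos y (reach_of_cell hp hq hpq hp2 hq2 M hM π hπpos hπzero hπinv y hy)).ne'
      · exact support_vecMul_prod _ Λ (fun l x z hx h => letter_reach hM hπzero hΛ l x z hx h) _ _ hesupp
      · rw [List.filter_append, List.length_append]; omega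
    · exact lt_of_head Λ hrows _ _ _ (lt_of_le_of_ne (l1_mul_prod_le Λ hrows _ _) hex)
  · -- the first `k` letters are plain
    obtain ⟨Xp, hXp⟩ := exists_plain (word.take k) hnone
    have hlen : k ≤ word.length := by
      have := List.length_filter_le (fun l => decide (l ≠ none ∧ l ≠ some (false, false))) word
      omega
    have hXlen : p * q ≤ 2 ^ Xp.length := by
      have : (word.take k).length = Xp.length := by rw [hXp, List.length_map]
      rw [List.length_take, min_eq_left hlen] at this
      rw [← this]
      exact Nat.lt_two_pow_self.le
    have hmap : (word.take k).map Λ = Xp.map M := by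
      rw [hXp, List.map_map]
      congr 1
      funext ab
      subst hΛ
      rfl
    by_cases hex : ∑ z, |(Pi.single s (1 : ℝ) ᵥ* ((word.take k).map Λ).prod) z| =
        ∑ x, |(Pi.single s (1 : ℝ) : Fin p × Fin q → ℝ) x|
    · refine lt_of_tail Λ hrows _ (word.take k) (word.drop k) (endgame₂ hp hq hpq hp2 hq2 hM
        hπpos hπzero hπsum hπinv hΛ (word.drop k) _ (fun y hy => ?_) ?_ hZ)
      · obtain ⟨c, T, hT, hs1, hs2⟩ := hs
        rw [hmap] at hex ⊢
        exact full_of_exact_plain hp hq hpq hp2 hq2 M hM Xp hXlen _ c T hT hex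
          ⟨s, hs1, hs2, by simp⟩ y hy
      · exact support_vecMul_prod _ Λ (fun l x z hx h => letter_reach hM hπzero hΛ l x z hx h) _ _ hesupp
    · exact lt_of_head Λ hrows _ _ _ (lt_of_le_of_ne (l1_mul_prod_le Λ hrows _ _) hex)

end SignAnalysis

/-- NO EXACT TWISTED CYCLE (stub `stub_noExactTwistedCycle` of the crux `QuadraticDigitPhases`, line
`Sketch`), uniformly for all pairs of distinct odd primes: for the invariant vector `π` of the untwisted
pair-carry letter, every generalized word in the letters `M_{ab}` and `Π = 𝟙 ⊗ π` with at least
`m₀ = pq + 2` twisted letters has absolute row sums `< 1` at every reachable state.  See the module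
docstring for the proof. -/
theorem stub_noExactTwistedCycle :
    ∀ p q : ℕ, p.Prime → q.Prime → p ≠ q → 2 < p → 2 < q → (∀ π : Fin p × Fin q → ℝ, (∀ s : Fin p × Fin q, (∃ c T : ℕ, T < 2 ^ c ∧ (s.1 : ℕ) = p * T / 2 ^ c ∧ (s.2 : ℕ) = q * T / 2 ^ c) → 0 < π s) → (∀ s : Fin p × Fin q, ¬ (∃ c T : ℕ, T < 2 ^ c ∧ (s.1 : ℕ) = p * T / 2 ^ c ∧ (s.2 : ℕ) = q * T / 2 ^ c) → π s = 0) → (∑ s : Fin p × Fin q, π s = 1) → (∀ y : Fin p × Fin q, ∑ x : Fin p × Fin q, π x * (Matrix.of fun (x y : Fin p × Fin q) => ∑ t ∈ ({0, 1} : Finset ℕ), if (y.1 : ℕ) = (p * t + x.1) / 2 ∧ (y.2 : ℕ) = (q * t + x.2) / 2 then (1 / 2 : ℝ) else 0) x y = π y) → ∃ m₀ : ℕ, ∀ word : List (Option (Bool × Bool)), m₀ ≤ (word.filter (fun l => l ≠ none ∧ l ≠ some (false, false))).length → ∀ s : Fin p × Fin q, (∃ c T : ℕ, T < 2 ^ c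 ∧ (s.1 : ℕ) = p * T / 2 ^ c ∧ (s.2 : ℕ) = q * T / 2 ^ c) → ∑ y : Fin p × Fin q, |((word.map (fun l : Option (Bool × Bool) => l.elim (Matrix.of fun (_ y : Fin p × Fin q) => π y) (fun ab : Bool × Bool => (Matrix.of fun (x y : Fin p × Fin q) => ∑ t ∈ ({0, 1} : Finset ℕ), if (y.1 : ℕ) = (p * t + x.1) / 2 ∧ (y.2 : ℕ) = (q * t + x.2) / 2 then (1 / 2 : ℝ) * (if ab.1 then (-1 : ℝ) ^ ((p * t + x.1) % 2) else 1) * (if ab.2 then (-1 : ℝ) ^ ((q * t + x.2) % 2) else 1) else 0)))).prod) s y| < 1) :=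
  fun _ _ hp hq hpq hp2 hq2 _ hπpos hπzero hπsum hπinv =>
    noExact_main hp hq hpq hp2 hq2 rfl hπpos hπzero hπsum hπinv rfl

end Summit.QuantumAdvantage.QuantumAdvantage.Theorems.MobiusLadderQuadraticDigitPhasesStubNoExactTwistedCycle
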